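import Summits.RiemannHypothesis.RiemannHypothesis.Theorems.GroundBartaEvenWinsBeyondArchDeflationPrimeY5
import Summits.RiemannHypothesis.RiemannHypothesis.Theorems.GroundBartaEvenWinsBeyondArchDeflationFivePrimeWindow
import HarnessLib

/-!
# RiemannHypothesis / GroundBarta — the parity ladder past `a = 1`: the prime increments of a scaled window polynomial
# on the `{2,3,4,5,7}`-window `(log 7)/2 < b ≤ (log 8)/2`

Helper file (`--supports stmt-RiemannHypothesis-18085`), RH-free.  Prover A (gen 23 of unit `sr-gb-rung-a`).

The `{2,3,4,5}`-window version (`…DeflationPrimeY5`: `primeBoundsY5` / `primeCheckY5` / `dt_primeSum_windowPolyY5_mem`) extended by the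
one new visible prime of the windows `(log 7)/2 < b ≤ (log 8)/2` (e.g. `b = 1`, `e² = 7.39`): for `v(x) = 𝟙_{[-b,b]}(x) P(x/b)` with a
certified increment polynomial `E` (`D_t(v) = t·E(t/b)` on `[0, 2b]`),
`Σ_{n ∈ weilPrimeIndex b} Λ(n) n^{-1/2} D_{log n}(v) = (log 2)²/√2 · E(log 2/b) + (log 3)²/√3 · E(log 3/b) + (log 2)² E(log 4/b)
   + (log 5)²/√5 · E(log 5/b) + (log 7)²/√7 · E(log 7/b)` (`dt_f7_sum_weilPrimeIndex`).
Same re-centred interval Horner enclosures (`evalAtLogMI`), one more `MI.logNat` and one more rational square-root bracket: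
`primeBoundsY7` / `primeCheckY7` / `dt_primeSum_windowPolyY7_mem` is the kernel certificate the A-layer finals of the cells beyond `1` call.

References: E. Bombieri, Rend. Mat. Acc. Lincei (9) 11 (2000) 183–233, Thm 2 [Bombieri2000Weil].
-/

set_option linter.dupNamespace false

noncomputable section

open MeasureTheory Set
open scoped BigOperators

namespace Summit.RiemannHypothesis.RiemannHypothesis.Theorems.EvenWinsBeyondArch

open Literature.NumberTheory.LFunctions Literature.Analysis.ValidatedNumerics.ExpPoly
open Literature.Analysis.ValidatedNumerics.PolyMP Literature.Analysis.ValidatedNumerics.NumericsMP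

/-- The prime-sum enclosure on the `{2,3,4,5,7}`-window (scaled integers):
`(log 2)²/√2 · E(log 2/b) + (log 3)²/√3 · E(log 3/b) + (log 2)² E(log 4/b) + (log 5)²/√5 · E(log 5/b) + (log 7)²/√7 · E(log 7/b)`,
with `1/√n ∈ [ilo_n, ihi_n]` rational brackets (`n = 2, 3, 5, 7`). [folklore] -/
def primeBoundsY7 (S K : ℕ) (E : Poly) (b L2 L3 L4 L5 L7 i2lo i2hi i3lo i3hi i5lo i5hi i7lo i7hi : ℚ) : ℤ × ℤ :=
  let l2 : MI := logNatMI S K 2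
  let l3 : MI := logNatMI S K 3
  let l5 : MI := logNatMI S K 5
  let l7 : MI := logNatMI S K 7
  let t2 : MI := MI.mul S (MI.mul S (MI.mul S l2 l2) (ratBracketMI S i2lo i2hi)) (evalAtLogMI S K E b L2 2)
  let t3 : MI := MI.mul S (MI.mul S (MI.mul S l3 l3) (ratBracketMI S i3lo i3hi)) (evalAtLogMI S K E b L3 3)
  let t4 : MI := MI.mul S (MI.mul S l2 l2) (evalAtLogMI S K E b L4 4)
  let t5 : MI := MI.mul S (MI.mul S (MI.mul S l5 l5) (ratBracketMI S i5lo i5hi)) (evalAtLogMI S K E b L5 5)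
  let t7 : MI := MI.mul S (MI.mul S (MI.mul S l7 l7) (ratBracketMI S i7lo i7hi)) (evalAtLogMI S K E b L7 7)
  let R : MI := MI.add (MI.add (MI.add (MI.add t2 t3) t4) t5) t7
  (R.lo, R.hi)

/-- The prime-sum check on the `{2,3,4,5,7}`-window: the `log` enclosures succeed and the `1/√n` brackets are valid
(`ilo, ihi ≥ 0`, `ilo² n ≤ 1 ≤ ihi² n` for `n = 2, 3, 5, 7`). [folklore] -/
def primeCheckY7 (S K : ℕ) (i2lo i2hi i3lo i3hi i5lo i5hi i7lo i7hi : ℚ) : Bool :=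
  primeCheckY5 S K i2lo i2hi i3lo i3hi i5lo i5hi && (MI.logNat S K 7).isSome &&
    decide (0 ≤ i7lo) && decide (i7lo ^ 2 * 7 ≤ 1) && decide (0 ≤ i7hi) && decide (1 ≤ i7hi ^ 2 * 7)

/-- **Kernel-certified prime increments of a scaled window polynomial on the `{2,3,4,5,7}`-window.**
[cite: Bombieri2000Weil, Thm 2] -/
theorem dt_primeSum_windowPolyY7_mem (P E : Poly) {b : ℚ} (hb7 : Real.log 7 / 2 < (b : ℝ))
    (hb8 : (b : ℝ) ≤ Real.log 8 / 2)
    (hE : ∀ τ : ℝ, τ * Poly.eval E τ = Poly.eval (Poly.smul 2 (Poly.corr P P 1)) 0 - Poly.eval (Poly.smul 2 (Poly.corr P P 1)) τ)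
    {S K : ℕ} (hS : 0 < S) (L2 L3 L4 L5 L7 i2lo i2hi i3lo i3hi i5lo i5hi i7lo i7hi : ℚ)
    (hchk : primeCheckY7 S K i2lo i2hi i3lo i3hi i5lo i5hi i7lo i7hi = true) :
    ((primeBoundsY7 S K E b L2 L3 L4 L5 L7 i2lo i2hi i3lo i3hi i5lo i5hi i7lo i7hi).1 : ℝ) / S ≤
        ∑ n ∈ weilPrimeIndex (b : ℝ), (ArithmeticFunction.vonMangoldt n : ℝ) / Real.sqrt n *
          weilIncrement (fun x : ℝ ↦ (((Set.Icc (-(b : ℝ)) b).indicator (fun x ↦ Poly.eval P (x / b)) x : ℝ) : ℂ))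
            (Real.log n) ∧
      ∑ n ∈ weilPrimeIndex (b : ℝ), (ArithmeticFunction.vonMangoldt n : ℝ) / Real.sqrt n *
          weilIncrement (fun x : ℝ ↦ (((Set.Icc (-(b : ℝ)) b).indicator (fun x ↦ Poly.eval P (x / b)) x : ℝ) : ℂ))
            (Real.log n) ≤
        ((primeBoundsY7 S K E b L2 L3 L4 L5 L7 i2lo i2hi i3lo i3hi i5lo i5hi i7lo i7hi).2 : ℝ) / S := by
  unfold primeCheckY7 primeCheckY5 primeCheckY at hchk
  simp only [Bool.and_eq_true, decide_eq_true_eq] at hchk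
  obtain ⟨⟨⟨⟨⟨⟨⟨⟨⟨⟨⟨⟨⟨⟨⟨⟨⟨⟨⟨⟨hl2, hl3⟩, hl4⟩, h20⟩, h21⟩, h22'⟩, h22⟩, h30⟩, h31⟩, h32'⟩, h32⟩, hl5⟩, h50⟩, h51⟩,
    h52'⟩, h52⟩, hl7⟩, h70⟩, h71⟩, h72'⟩, h72⟩ := hchk
  have hlog2 : 0 < Real.log 2 := Real.log_pos (by norm_num)
  have hb5 : Real.log 5 / 2 < (b : ℝ) := lt_trans dt_f7_log5half_lt_log7half hb7
  have hb2 : Real.log 2 < (b : ℝ) := lt_trans dt_fp_log_two_lt_log_five_half hb5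
  have hbpos : (0 : ℝ) < b := lt_trans hlog2 hb2
  have hbq : 0 < b := by exact_mod_cast hbpos
  -- the five increments through `E`
  have hD : ∀ n : ℕ, 1 ≤ n → Real.log n ≤ 2 * (b : ℝ) →
      weilIncrement (fun x : ℝ ↦ (((Set.Icc (-(b : ℝ)) b).indicator (fun x ↦ Poly.eval P (x / b)) x : ℝ) : ℂ))
        (Real.log n) = Real.log n * Poly.eval E (Real.log n / b) := by
    intro n hn hle
    exact dt_weilIncrement_windowPolyY_of_le P E hbq hE (Real.log_nonneg (by exact_mod_cast hn)) hle
  have hlog4 : Real.log (4 : ℕ) = 2 * Real.log 2 := by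
    rw [show ((4 : ℕ) : ℝ) = 2 ^ 2 by norm_num, Real.log_pow]; ring
  have hle2 : Real.log (2 : ℕ) ≤ 2 * (b : ℝ) := by push_cast; linarith
  have hle3 : Real.log (3 : ℕ) ≤ 2 * (b : ℝ) := by
    push_cast
    have : Real.log 3 < Real.log 4 := Real.log_lt_log (by norm_num) (by norm_num)
    have h4 : Real.log 4 = 2 * Real.log 2 := by
      rw [show (4 : ℝ) = 2 ^ 2 by norm_num, Real.log_pow]; ring
    linarith
  have hle4 : Real.log (4 : ℕ) ≤ 2 * (b : ℝ) := by rw [hlog4]; linarith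
  have hle5 : Real.log (5 : ℕ) ≤ 2 * (b : ℝ) := by push_cast; linarith
  have hle7 : Real.log (7 : ℕ) ≤ 2 * (b : ℝ) := by push_cast; linarith
  rw [dt_f7_sum_weilPrimeIndex hb7 hb8, hD 2 (by norm_num) hle2, hD 3 (by norm_num) hle3, hD 4 (by norm_num) hle4,
    hD 5 (by norm_num) hle5, hD 7 (by norm_num) hle7]
  -- enclosures
  have m2 := mem_logNatMI hS hl2
  have m3 := mem_logNatMI hS hl3
  have m5 := mem_logNatMI hS hl5
  have m7 := mem_logNatMI hS hl7
  have e2 := mem_evalAtLogMI hS E b L2 hl2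
  have e3 := mem_evalAtLogMI hS E b L3 hl3
  have e4 := mem_evalAtLogMI hS E b L4 hl4
  have e5 := mem_evalAtLogMI hS E b L5 hl5
  have e7 := mem_evalAtLogMI hS E b L7 hl7
  obtain ⟨i2a, i2b⟩ := inv_sqrt_mem_of_bracket (n := 2) (by norm_num) h20 h21 h22' h22
  obtain ⟨i3a, i3b⟩ := inv_sqrt_mem_of_bracket (n := 3) (by norm_num) h30 h31 h32' h32
  obtain ⟨i5a, i5b⟩ := inv_sqrt_mem_of_bracket (n := 5) (by norm_num) h50 h51 h52' h52
  obtain ⟨i7a, i7b⟩ := inv_sqrt_mem_of_bracket (n := 7) (by norm_num) h70 h71 h72' h72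
  have s2 := mem_ratBracketMI S i2a i2b
  have s3 := mem_ratBracketMI S i3a i3b
  have s5 := mem_ratBracketMI S i5a i5b
  have s7 := mem_ratBracketMI S i7a i7b
  have t2 := MI.mem_mul hS (MI.mem_mul hS (MI.mem_mul hS m2 m2) s2) e2
  have t3 := MI.mem_mul hS (MI.mem_mul hS (MI.mem_mul hS m3 m3) s3) e3
  have t4 := MI.mem_mul hS (MI.mem_mul hS m2 m2) e4
  have t5 := MI.mem_mul hS (MI.mem_mul hS (MI.mem_mul hS m5 m5) s5) e5
  have t7 := MI.mem_mul hS (MI.mem_mul hS (MI.mem_mul hS m7 m7) s7) e7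
  have hR := MI.mem_add (MI.mem_add (MI.mem_add (MI.mem_add t2 t3) t4) t5) t7
  obtain ⟨hlo, hhi⟩ := hR
  have hSr : (0 : ℝ) < S := by exact_mod_cast hS
  -- identify the enclosed quantity with the five-prime-power sum
  have hval : Real.log (2 : ℕ) * Real.log (2 : ℕ) * (1 / Real.sqrt (2 : ℕ)) * Poly.eval E (Real.log (2 : ℕ) / b) +
        Real.log (3 : ℕ) * Real.log (3 : ℕ) * (1 / Real.sqrt (3 : ℕ)) * Poly.eval E (Real.log (3 : ℕ) / b) +
        Real.log (2 : ℕ) * Real.log (2 : ℕ) * Poly.eval E (Real.log (4 : ℕ) / b) +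
        Real.log (5 : ℕ) * Real.log (5 : ℕ) * (1 / Real.sqrt (5 : ℕ)) * Poly.eval E (Real.log (5 : ℕ) / b) +
        Real.log (7 : ℕ) * Real.log (7 : ℕ) * (1 / Real.sqrt (7 : ℕ)) * Poly.eval E (Real.log (7 : ℕ) / b) =
      Real.log 2 / Real.sqrt 2 * (Real.log (2 : ℕ) * Poly.eval E (Real.log (2 : ℕ) / b)) +
        Real.log 3 / Real.sqrt 3 * (Real.log (3 : ℕ) * Poly.eval E (Real.log (3 : ℕ) / b)) +
        Real.log 2 / 2 * (Real.log (4 : ℕ) * Poly.eval E (Real.log (4 : ℕ) / b)) +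
        Real.log 5 / Real.sqrt 5 * (Real.log (5 : ℕ) * Poly.eval E (Real.log (5 : ℕ) / b)) +
        Real.log 7 / Real.sqrt 7 * (Real.log (7 : ℕ) * Poly.eval E (Real.log (7 : ℕ) / b)) := by
    rw [hlog4]; push_cast; ring
  unfold primeBoundsY7
  simp only []
  constructor
  · rw [div_le_iff₀ hSr, ← hval]; exact hlo
  · rw [le_div_iff₀ hSr, ← hval]; exact hhi

end Summit.RiemannHypothesis.RiemannHypothesis.Theorems.EvenWinsBeyondArch

end
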